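import Literature.NumberTheory.EllipticCurves.Gamma0RankinSelbergMoebiusAssembly
import Literature.NumberTheory.EllipticCurves.NewformPeterssonSizeSymmSquareProofs
import HarnessLib

/-!
# The holomorphic continuation of `(s − 1) ζ(2s) Σₙ |aₙ|² n^{-(s+1)}` for `f ∈ S₂(Γ₀(N))`

Topic `Literature/NumberTheory/EllipticCurves`; definitions with bodies (`moebiusWeightC`, the
entire pieces `rankinJ₀` and the continued function `rankinLambda`) and theorems. The complex-variable
conclusion of the series `Gamma0EisensteinMoebius` → `CuspFormConjugatedTrace` →
`Gamma0RankinSelbergScaledUnfolding` → `Gamma0RankinSelbergMoebiusAssembly`: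

* `moebiusWeightC N s = J_s(N) = Σ_{de=N} μ(d) e^{2s}` for complex `s` (entire; `= moebiusWeight σ N` at
  real points; `= ∏_{p^k ∥ N}((p^{2s})^k − (p^{2s})^{k−1})` by analytic continuation of the real product
  formula, hence **non-zero for `Re s > 0`**);
* `eqOn_of_differentiableOn_of_eq_ofReal` — the identity-theorem step used twice: two functions
  holomorphic on an open preconnected `U` containing the real ray `(a, ∞)` and equal there coincide on `U`;
* `LSeries_normSq_cuspCoeff_eq_sum_divisors_complex` — Rankin's identity of
  `Gamma0RankinSelbergMoebiusAssembly` continued to `{Re s > 1}`: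
  `L(|a|², s+1) = J_s(N)⁻¹ Σ_{t∣N} μ(N/t) tˢ (Nt)^{s+1} L(conjCoeff_t, s+1)`;
* `rankinJ₀ N t f s = ∫_𝒟 G_f^{(t)} E₀*(·, s) dμ` — ENTIRE (`differentiable_J₀` of
  `RankinSelbergContinuationSL2`) and, for `Re s > 1`,
  `= θ(s) Γ(s+1) a_t^{-(s+1)} L(conjCoeff_t, s+1) + V_t (1/(2s) + 1/(2(1−s)))`, `θ(s) = π^{-s}Γ(s)ζ(2s)`,
  `a_t = 4π/(Nt)`, `V_t = ∫_𝒟 G_f^{(t)} dμ` (`J₀_eq_of_one_lt_re`);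
* **`rankinLambda N f s := J_s(N)⁻¹ Σ_{t∣N} μ(N/t) tˢ ((s−1)·rankinJ₀ t s − V_t((s−1)/(2s) − 1/2))`**:
  `differentiableOn_rankinLambda` — holomorphic on `{Re s > 0}`;
  `rankinLambda_eq_of_one_lt_re` — for `Re s > 1`,
  **`rankinLambda N f s = (s − 1) · π^{-s}Γ(s)ζ(2s) · Γ(s+1)(4π)^{-(s+1)} · L(|a|², s+1)`**;
  `rankinLambda_one` — `rankinLambda N f 1 = J_1(N)⁻¹ Σ_{t∣N} μ(N/t) t · V_t/2`, and with
  `V_t = Re (f, f)` (`integral_fd_conjTrace_eq_re_peterssonProduct`), `Σ_{t∣N}μ(N/t)t = φ(N)`,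
  `J_1(N) = [SL₂(ℤ):Γ₀(N)] φ(N)`: **`rankinLambda N f 1 = Re (f, f)/(2 [SL₂(ℤ):Γ₀(N)])`**
  (`rankinLambda_one_eq`).

So for every `f ∈ S₂(Γ₀(N))` the function `(s − 1)·ζ(2s)·Σ|aₙ|²n^{-(s+1)}` times the entire,
zero-free factor `π^{-s}Γ(s)Γ(s+1)(4π)^{-(s+1)}` extends holomorphically from `Re s > 1` to `Re s > 0`
(Rankin 1939, Thm. 3; Shimura 1975 / Zagier 1981 for the formulation through `E*`), with the value at
`s = 1` identified with the Petersson norm: the residue of Rankin's series at the edge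
(`Res_{w=2} Σ|aₙ|²n^{-w} = 48π(f,f)/[SL₂(ℤ):Γ₀(N)]`, cf. `Gamma0RankinSelbergResidue`) now inside a
holomorphic function. For the newform of an elliptic curve this is the `GL(2)` input (holomorphy near
`s = 1` of `ζ(s)L(s, Sym² f)` up to harmless factors, value at `1`) of the Hoffstein–Lockhart family
datum behind the named fact `murty_petersson_newform_lower_bound` (`NewformPeterssonSizeSiegelReductionProofs`,
`SiegelTheoremPairAbstract`); polynomial bounds in `N` are NOT addressed here.

## References

* R. A. Rankin, Proc. Cambridge Philos. Soc. 35 (1939), 357–372, Thm. 3. [Rankin1939]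
* D. Zagier, *The Rankin–Selberg method for automorphic functions which are not of rapid decay*,
  J. Fac. Sci. Univ. Tokyo 28 (1981), 415–437, §1.
* G. Shimura, *On the holomorphy of certain Dirichlet series*, Proc. LMS 31 (1975), 79–98.
-/

noncomputable section

open scoped MatrixGroups ModularForm Modular Real Topology ENNReal NNReal Pointwise
open UpperHalfPlane hiding I
open MeasureTheory Set Filter ModularGroup ConjAct CongruenceSubgroup ArithmeticFunction Complex
open scoped ArithmeticFunction.Moebius
open Literature.NumberTheory.Automorphic

namespace Literature.NumberTheory.EllipticCurves.ModularForms

/-! ### The identity theorem from the real ray -/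

/-- **Identity theorem from a real ray.** If `F, G` are holomorphic on an open preconnected `U ⊆ ℂ`
containing the real points `σ > a`, and `F σ = G σ` for all real `σ > a`, then `F = G` on `U`.
[folklore] -/
theorem eqOn_of_differentiableOn_of_eq_ofReal {U : Set ℂ} (hU : IsOpen U) (hUc : IsPreconnected U)
    {F G : ℂ → ℂ} (hF : DifferentiableOn ℂ F U) (hG : DifferentiableOn ℂ G U) {a : ℝ}
    (hmem : ∀ σ : ℝ, a < σ → (σ : ℂ) ∈ U) (heq : ∀ σ : ℝ, a < σ → F σ = G σ) : EqOn F G U := by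
  have z₀mem : ((a + 1 : ℝ) : ℂ) ∈ U := hmem _ (by linarith)
  refine (hF.analyticOnNhd hU).eqOn_of_preconnected_of_frequently_eq (hG.analyticOnNhd hU) hUc z₀mem ?_
  rw [Filter.frequently_iff]
  intro V hV
  obtain ⟨ε, hε, hball⟩ := Metric.mem_nhdsWithin_iff.mp hV
  refine ⟨((a + 1 + ε / 2 : ℝ) : ℂ), hball ⟨?_, ?_⟩, heq _ (by linarith)⟩
  · rw [Metric.mem_ball, dist_eq_norm, ← Complex.ofReal_sub, Complex.norm_real, Real.norm_eq_abs,
      show a + 1 + ε / 2 - (a + 1) = ε / 2 by ring, abs_of_pos (by linarith)]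
    linarith
  · simp only [mem_compl_iff, mem_singleton_iff, Complex.ofReal_inj]
    intro h; linarith

/-- The right half-planes `{Re s > c}` are open and preconnected. [folklore] -/
theorem isOpen_isPreconnected_re_gt (c : ℝ) :
    IsOpen {s : ℂ | c < s.re} ∧ IsPreconnected {s : ℂ | c < s.re} :=
  ⟨isOpen_lt continuous_const Complex.continuous_re,
    (convex_halfSpace_re_gt c).isPreconnected⟩

/-! ### The complex Möbius weight `J_s(N)` -/

/-- **`J_s(N) = Σ_{de = N} μ(d) e^{2s}`** for complex `s`. [cite: DiamondShurman2005, §4.2] -/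
def moebiusWeightC (N : ℕ) (s : ℂ) : ℂ :=
  ∑ x ∈ N.divisorsAntidiagonal, (μ x.1 : ℂ) * (x.2 : ℂ) ^ (2 * s)

/-- At real points `J_σ(N)` is the real Möbius weight. [folklore] -/
theorem moebiusWeightC_ofReal (N : ℕ) (σ : ℝ) : moebiusWeightC N σ = (moebiusWeight σ N : ℂ) := by
  unfold moebiusWeightC moebiusWeight
  push_cast
  refine Finset.sum_congr rfl fun x _ ↦ ?_
  rw [show (2 : ℂ) * (σ : ℂ) = ((2 * σ : ℝ) : ℂ) by push_cast; ring, ← Complex.ofReal_natCast,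
    ← Complex.ofReal_cpow (Nat.cast_nonneg _)]

/-- `J_s(N)` is entire. [folklore] -/
theorem differentiable_moebiusWeightC (N : ℕ) : Differentiable ℂ (moebiusWeightC N) := by
  unfold moebiusWeightC
  apply Differentiable.fun_sum
  intro x hx
  have hx2 : (x.2 : ℂ) ≠ 0 := by
    have := Nat.mem_divisorsAntidiagonal.mp hx
    exact_mod_cast fun h ↦ this.2 (by rw [← this.1, h, mul_zero])
  exact ((differentiable_id.const_mul 2).const_cpow (Or.inl hx2)).const_mul _

/-- The complex product `∏_{p^k ∥ N} ((p^{2s})^k − (p^{2s})^{k−1})`. [folklore] -/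
def moebiusWeightProdC (N : ℕ) (s : ℂ) : ℂ :=
  N.factorization.prod fun p k ↦ ((p : ℂ) ^ (2 * s)) ^ k - ((p : ℂ) ^ (2 * s)) ^ (k - 1)

/-- The product is entire. [folklore] -/
theorem differentiable_moebiusWeightProdC (N : ℕ) : Differentiable ℂ (moebiusWeightProdC N) := by
  unfold moebiusWeightProdC Finsupp.prod
  show Differentiable ℂ fun s : ℂ ↦ ∏ p ∈ N.factorization.support,
    (((p : ℂ) ^ (2 * s)) ^ (N.factorization p) - ((p : ℂ) ^ (2 * s)) ^ (N.factorization p - 1))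
  apply Differentiable.fun_finsetProd
  intro p hp
  have hp' : p.Prime := Nat.prime_of_mem_primeFactors (Nat.support_factorization N ▸ hp)
  have hp0 : (p : ℂ) ≠ 0 := by exact_mod_cast hp'.ne_zero
  have hd : Differentiable ℂ fun s : ℂ ↦ (p : ℂ) ^ (2 * s) := (differentiable_id.const_mul 2).const_cpow (Or.inl hp0)
  exact (hd.pow _).sub (hd.pow _)

/-- At real points the complex product is the real product. [folklore] -/
theorem moebiusWeightProdC_ofReal {N : ℕ} (hN : N ≠ 0) (σ : ℝ) :
    moebiusWeightProdC N σ = (moebiusWeight σ N : ℂ) := by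
  rw [moebiusWeight_eq_prod_factorization σ hN]
  unfold moebiusWeightProdC Finsupp.prod
  push_cast
  refine Finset.prod_congr rfl fun p _ ↦ ?_
  rw [show (2 : ℂ) * (σ : ℂ) = ((2 * σ : ℝ) : ℂ) by push_cast; ring, ← Complex.ofReal_natCast,
    ← Complex.ofReal_cpow (Nat.cast_nonneg _)]

/-- **`J_s(N) = ∏_{p^k ∥ N} ((p^{2s})^k − (p^{2s})^{k−1})`** for all complex `s` (both sides are entire and
agree at real points). [cite: DiamondShurman2005, §4.2] -/
theorem moebiusWeightC_eq_prod {N : ℕ} (hN : N ≠ 0) (s : ℂ) : moebiusWeightC N s = moebiusWeightProdC N s := by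
  have h := eqOn_of_differentiableOn_of_eq_ofReal isOpen_univ isPreconnected_univ
    (differentiable_moebiusWeightC N).differentiableOn (differentiable_moebiusWeightProdC N).differentiableOn
    (a := 0) (fun σ _ ↦ mem_univ _) (fun σ _ ↦ by rw [moebiusWeightC_ofReal, moebiusWeightProdC_ofReal hN])
  exact h (mem_univ s)

/-- **`J_s(N) ≠ 0` for `Re s > 0`** (`|p^{2s}| = p^{2 Re s} > 1` in each factor). [cite: DiamondShurman2005, §4.2] -/
theorem moebiusWeightC_ne_zero {N : ℕ} (hN : N ≠ 0) {s : ℂ} (hs : 0 < s.re) : moebiusWeightC N s ≠ 0 := by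
  rw [moebiusWeightC_eq_prod hN]
  unfold moebiusWeightProdC Finsupp.prod
  refine Finset.prod_ne_zero_iff.mpr fun p hp ↦ ?_
  have hp' : p.Prime := Nat.prime_of_mem_primeFactors (Nat.support_factorization N ▸ hp)
  have hk : 0 < N.factorization p := Nat.pos_of_ne_zero (Finsupp.mem_support_iff.mp hp)
  obtain ⟨k, hk'⟩ : ∃ k, N.factorization p = k + 1 := ⟨N.factorization p - 1, by omega⟩
  dsimp only
  rw [hk', Nat.add_sub_cancel, pow_succ, ← mul_sub_one]
  have hp0 : (p : ℂ) ≠ 0 := by exact_mod_cast hp'.ne_zero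
  refine mul_ne_zero (pow_ne_zero _ fun h ↦ hp0 ((cpow_eq_zero_iff _ _).mp h).1) (sub_ne_zero.mpr ?_)
  · intro h1
    have hn := congrArg (fun z : ℂ ↦ ‖z‖) h1
    simp only [norm_one] at hn
    rw [Complex.norm_natCast_cpow_of_pos hp'.pos] at hn
    have hgt : 1 < (p : ℝ) ^ (2 * s).re :=
      Real.one_lt_rpow (by exact_mod_cast hp'.one_lt) (by simp; linarith)
    linarith

/-! ### Rankin's identity continued to `Re s > 1` -/

section DirichletComplex

variable {N : ℕ} [NeZero N]

/-- The abscissa of absolute convergence of `Σ |aₙ|² n^{-w}` is at most `2`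
(`summable_normSq_cuspCoeff_div_rpow`). [cite: Rankin1939, convergence of Σ|aₙ|²n^{-s} for Re s > k] -/
theorem abscissaOfAbsConv_normSq_cuspCoeff_le (f : CuspForm (Gamma0 N) 2) :
    LSeries.abscissaOfAbsConv (fun n ↦ ((‖cuspCoeff f n‖ ^ 2 : ℝ) : ℂ)) ≤ (2 : ℝ) := by
  refine LSeries.abscissaOfAbsConv_le_of_forall_lt_LSeriesSummable fun x hx ↦ ?_
  refine Summable.of_norm ?_
  refine (summable_normSq_cuspCoeff_div_rpow f hx).congr fun n ↦ ?_
  rw [LSeries.norm_term_eq]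
  rcases Nat.eq_zero_or_pos n with rfl | hn
  · simp [Real.zero_rpow (by linarith : x ≠ 0)]
  · rw [if_neg hn.ne', Complex.norm_real, Real.norm_of_nonneg (sq_nonneg _), Complex.ofReal_re]

/-- The abscissa of absolute convergence of `Σ conjCoeff_t(n) n^{-w}` is at most `2`. [folklore] -/
theorem abscissaOfAbsConv_conjCoeff_le {t : ℕ} [NeZero t] (f : CuspForm (Gamma0 N) 2) :
    LSeries.abscissaOfAbsConv (fun n ↦ (conjCoeff N t f n : ℂ)) ≤ (2 : ℝ) :=
  LSeries.abscissaOfAbsConv_le_of_forall_lt_LSeriesSummable fun x hx ↦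
    LSeriesSummable_conjCoeff (N := N) (t := t) f (by simpa using hx)

/-- `s ↦ L(b, s + 1)` is holomorphic on `{Re s > 1}` when the abscissa of `b` is at most `2`. [folklore] -/
theorem differentiableOn_LSeries_add_one {b : ℕ → ℂ} (hb : LSeries.abscissaOfAbsConv b ≤ (2 : ℝ)) :
    DifferentiableOn ℂ (fun s : ℂ ↦ LSeries b (s + 1)) {s : ℂ | 1 < s.re} := by
  refine (LSeries_differentiableOn b).comp (differentiable_id.add_const 1).differentiableOn fun s hs ↦ ?_
  simp only [mem_setOf_eq] at hs
  have h2 : (2 : ℝ) < (s + 1).re := by simp only [add_re, one_re]; linarith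
  exact hb.trans_lt (EReal.coe_lt_coe_iff.mpr h2)

/-- **Rankin's identity through the horocycle data, continued to `{Re s > 1}`**: for `f ∈ S₂(Γ₀(N))`,
`L(|a|², s+1) = J_s(N)⁻¹ Σ_{t∣N} μ(N/t) tˢ (Nt)^{s+1} L(conjCoeff_t, s+1)` on `Re s > 1` (both sides are
holomorphic there and agree at real points, `LSeries_normSq_cuspCoeff_eq_sum_divisors`).
[cite: Rankin1939, §4 Thm. 3] -/
theorem LSeries_normSq_cuspCoeff_eq_sum_divisors_complex (f : CuspForm (Gamma0 N) 2) {s : ℂ} (hs : 1 < s.re) :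
    LSeries (fun n ↦ ((‖cuspCoeff f n‖ ^ 2 : ℝ) : ℂ)) (s + 1) =
      (moebiusWeightC N s)⁻¹ * ∑ t ∈ N.divisors.attach, (μ (N / t.1) : ℂ) *
        ((t.1 : ℂ) ^ s * ((N * t.1 : ℕ) : ℂ) ^ (s + 1)) * LSeries (fun n ↦ (conjCoeff N t.1 f n : ℂ)) (s + 1) := by
  classical
  obtain ⟨g, hg⟩ := exists_mapGL_eq_out (N := N)
  letI : Fintype (↥𝒮ℒ ⧸ (Gamma0 N : Subgroup (GL (Fin 2) ℝ)).subgroupOf 𝒮ℒ) := Fintype.ofFinite _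
  have hN : N ≠ 0 := NeZero.ne N
  obtain ⟨hUo, hUc⟩ := isOpen_isPreconnected_re_gt (1 : ℝ)
  -- holomorphy of both sides on `{Re s > 1}`
  have hF : DifferentiableOn ℂ (fun s : ℂ ↦ LSeries (fun n ↦ ((‖cuspCoeff f n‖ ^ 2 : ℝ) : ℂ)) (s + 1))
      {s : ℂ | 1 < s.re} := differentiableOn_LSeries_add_one (abscissaOfAbsConv_normSq_cuspCoeff_le f)
  have hterm : ∀ tt : {x // x ∈ N.divisors}, DifferentiableOn ℂ (fun s : ℂ ↦ (μ (N / tt.1) : ℂ) *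
      ((tt.1 : ℂ) ^ s * ((N * tt.1 : ℕ) : ℂ) ^ (s + 1)) * LSeries (fun n ↦ (conjCoeff N tt.1 f n : ℂ)) (s + 1))
      {s : ℂ | 1 < s.re} := by
    intro tt
    haveI : NeZero tt.1 := ⟨(Nat.pos_of_mem_divisors tt.2).ne'⟩
    have ht0 : (tt.1 : ℂ) ≠ 0 := by exact_mod_cast NeZero.ne tt.1
    have hNt0 : ((N * tt.1 : ℕ) : ℂ) ≠ 0 := by exact_mod_cast Nat.mul_ne_zero hN (NeZero.ne tt.1)
    have hA : Differentiable ℂ fun s : ℂ ↦ (tt.1 : ℂ) ^ s * ((N * tt.1 : ℕ) : ℂ) ^ (s + 1) :=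
      (differentiable_id.const_cpow (Or.inl ht0)).mul ((differentiable_id.add_const 1).const_cpow (Or.inl hNt0))
    exact ((differentiableOn_const _).mul hA.differentiableOn).mul
      (differentiableOn_LSeries_add_one (abscissaOfAbsConv_conjCoeff_le (t := tt.1) f))
  have hG : DifferentiableOn ℂ (fun s : ℂ ↦ (moebiusWeightC N s)⁻¹ * ∑ t ∈ N.divisors.attach, (μ (N / t.1) : ℂ) *
      ((t.1 : ℂ) ^ s * ((N * t.1 : ℕ) : ℂ) ^ (s + 1)) * LSeries (fun n ↦ (conjCoeff N t.1 f n : ℂ)) (s + 1))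
      {s : ℂ | 1 < s.re} := by
    refine (((differentiable_moebiusWeightC N).differentiableOn.inv fun s hs ↦
      moebiusWeightC_ne_zero hN (by simp only [mem_setOf_eq] at hs; linarith))).mul ?_
    exact DifferentiableOn.fun_sum fun tt _ ↦ hterm tt
  -- equality at real points `σ > 1`
  have heq : ∀ σ : ℝ, 1 < σ → LSeries (fun n ↦ ((‖cuspCoeff f n‖ ^ 2 : ℝ) : ℂ)) ((σ : ℂ) + 1) =
      (moebiusWeightC N σ)⁻¹ * ∑ t ∈ N.divisors.attach, (μ (N / t.1) : ℂ) *
        ((t.1 : ℂ) ^ (σ : ℂ) * ((N * t.1 : ℕ) : ℂ) ^ ((σ : ℂ) + 1)) *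
          LSeries (fun n ↦ (conjCoeff N t.1 f n : ℂ)) ((σ : ℂ) + 1) := by
    intro σ hσ
    have h := LSeries_normSq_cuspCoeff_eq_sum_divisors g hg f hσ
    have e1 : ((σ : ℂ) + 1) = ((σ + 1 : ℝ) : ℂ) := by push_cast; ring
    rw [e1, h, moebiusWeightC_ofReal, Complex.ofReal_inv]
    congr 1
    refine Finset.sum_congr rfl fun tt _ ↦ ?_
    have htt : (0 : ℝ) ≤ tt.1 := Nat.cast_nonneg _
    have hNt : (0 : ℝ) ≤ ((N * tt.1 : ℕ) : ℝ) := Nat.cast_nonneg _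
    rw [show ((tt.1 : ℕ) : ℂ) = ((tt.1 : ℝ) : ℂ) by push_cast; rfl,
      show (((N * tt.1 : ℕ)) : ℂ) = ((((N * tt.1 : ℕ)) : ℝ) : ℂ) by push_cast; rfl,
      ← Complex.ofReal_cpow htt, ← Complex.ofReal_cpow hNt]
    push_cast
    ring
  exact eqOn_of_differentiableOn_of_eq_ofReal hUo hUc hF hG (a := 1)
    (fun σ hσ ↦ by simpa using hσ) heq hs

end DirichletComplex

/-! ### The entire pieces `J_t` and the continued function `Λ_f` -/

section Continuation

variable (N : ℕ) [NeZero N]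

/-- **`J_t(s) = ∫_𝒟 G_f^{(t)}(w) E₀*(w, s) dμ(w)`** (the conjugated trace against the entire part of the
completed Eisenstein series; the `J₀` of `RankinSelbergContinuationSL2` for the datum `G_f^{(t)}`).
[cite: Rankin1939, §4 (4.4.2)–(4.4.3)] -/
def rankinJ₀ (t : ℕ) (f : CuspForm (Gamma0 N) 2) (s : ℂ) : ℂ :=
  ∫ w in 𝒟, (conjTrace N t f w : ℂ) * completedEisenstein₀ w s

/-- **The mass `V_t = ∫_𝒟 G_f^{(t)} dμ`** (`= Re (f, f)` for `t ∣ N`, below). [cite: Rankin1939, §4] -/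
def rankinMass (t : ℕ) (f : CuspForm (Gamma0 N) 2) : ℝ :=
  ∫ w in 𝒟, conjTrace N t f w

/-- **The continued function**
`Λ_f(s) = J_s(N)⁻¹ Σ_{t∣N} μ(N/t) tˢ ((s − 1) J_t(s) − V_t ((s − 1)/(2s) − 1/2))`.
[cite: Rankin1939, Thm. 3] -/
def rankinLambda (f : CuspForm (Gamma0 N) 2) (s : ℂ) : ℂ :=
  (moebiusWeightC N s)⁻¹ * ∑ t ∈ N.divisors.attach, (μ (N / t.1) : ℂ) * (t.1 : ℂ) ^ s *
    ((s - 1) * rankinJ₀ N t.1 f s - (rankinMass N t.1 f : ℂ) * ((s - 1) / (2 * s) - 1 / 2))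

variable {N}
variable {t : ℕ} [NeZero t]

/-- **`J_t` is entire** (`differentiable_J₀` for the datum `G_f^{(t)}`). [cite: Rankin1939, Thm. 3] -/
theorem differentiable_rankinJ₀ (f : CuspForm (Gamma0 N) 2) : Differentiable ℂ (rankinJ₀ N t f) := by
  obtain ⟨B, -, hB⟩ := exists_conjTrace_le (N := N) (t := t) f
  obtain ⟨hGc, hGinv, hG0, hGB, hC, hC0, ha, hκ, hsum, -, hm⟩ := conjTrace_horocycle_datum f hB
  exact differentiable_J₀ hGc hGinv hG0 hGB hC hC0 ha hκ hsum hm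

/-- **`J_t` for `Re s > 1`**: `J_t(s) = π^{-s}Γ(s)ζ(2s) · Γ(s+1)(4π/(Nt))^{-(s+1)} L(conjCoeff_t, s+1)
+ (1/(2s) + 1/(2(1−s))) V_t` (`J₀_eq_of_one_lt_re`). [cite: Rankin1939, §4 (4.4.3)] -/
theorem rankinJ₀_eq_of_one_lt_re (f : CuspForm (Gamma0 N) 2) {s : ℂ} (hs : 1 < s.re) :
    rankinJ₀ N t f s =
      (π : ℂ) ^ (-s) * Complex.Gamma s * riemannZeta (2 * s) *
          (Complex.Gamma (s + 1) * ((4 * π / ((N * t : ℕ) : ℝ) : ℝ) : ℂ) ^ (-(s + 1)) *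
            LSeries (fun n ↦ (conjCoeff N t f n : ℂ)) (s + 1)) +
        (1 / (2 * s) + 1 / (2 * (1 - s))) * (rankinMass N t f : ℂ) := by
  obtain ⟨B, -, hB⟩ := exists_conjTrace_le (N := N) (t := t) f
  obtain ⟨hGc, hGinv, hG0, hGB, hC, hC0, ha, hκ, hsum, hle, hm⟩ := conjTrace_horocycle_datum f hB
  have h := J₀_eq_of_one_lt_re hGc hGinv hG0 hGB hC hC0 ha hκ hsum hle hm hs
  rw [rankinJ₀, h, show s + (2 : ℝ) - 1 = s + 1 by push_cast; ring, rankinMass, ← integral_complex_ofReal]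

/-- `(4π/(Nt))^{-(s+1)} = (4π)^{-(s+1)} (Nt)^{s+1}`. [folklore] -/
theorem horocycle_a_cpow (s : ℂ) :
    ((4 * π / ((N * t : ℕ) : ℝ) : ℝ) : ℂ) ^ (-(s + 1)) =
      ((4 * π : ℝ) : ℂ) ^ (-(s + 1)) * ((N * t : ℕ) : ℂ) ^ (s + 1) := by
  have hNt : (0 : ℝ) < ((N * t : ℕ) : ℝ) := by exact_mod_cast Nat.mul_pos (NeZero.pos N) (NeZero.pos t)
  rw [div_eq_mul_inv, Complex.ofReal_mul, Complex.mul_cpow_ofReal_nonneg (by positivity) (inv_nonneg.mpr hNt.le),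
    Complex.ofReal_inv, Complex.inv_cpow _ _ (by rw [Complex.arg_ofReal_of_nonneg hNt.le]; exact Real.pi_ne_zero.symm),
    Complex.cpow_neg, Complex.cpow_neg, inv_inv]
  norm_cast

/-- **`Λ_f` for `Re s > 1`**:
`Λ_f(s) = (s − 1) · π^{-s}Γ(s)ζ(2s) · Γ(s+1)(4π)^{-(s+1)} · L(|a|², s+1)`.
[cite: Rankin1939, Thm. 3] -/
theorem rankinLambda_eq_of_one_lt_re (f : CuspForm (Gamma0 N) 2) {s : ℂ} (hs : 1 < s.re) :
    rankinLambda N f s = (s - 1) * ((π : ℂ) ^ (-s) * Complex.Gamma s * riemannZeta (2 * s)) *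
      (Complex.Gamma (s + 1) * ((4 * π : ℝ) : ℂ) ^ (-(s + 1))) *
        LSeries (fun n ↦ ((‖cuspCoeff f n‖ ^ 2 : ℝ) : ℂ)) (s + 1) := by
  have hN : N ≠ 0 := NeZero.ne N
  have hJ : moebiusWeightC N s ≠ 0 := moebiusWeightC_ne_zero hN (by linarith)
  have hs0 : s ≠ 0 := fun h ↦ by rw [h, Complex.zero_re] at hs; linarith
  have hs1 : s ≠ 1 := fun h ↦ by rw [h, Complex.one_re] at hs; linarith
  have hs1' : (1 : ℂ) - s ≠ 0 := sub_ne_zero.mpr (Ne.symm hs1)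
  rw [LSeries_normSq_cuspCoeff_eq_sum_divisors_complex f hs, rankinLambda]
  -- the terms of the sum, one by one
  have hterm : ∀ tt : {x // x ∈ N.divisors},
      (μ (N / tt.1) : ℂ) * (tt.1 : ℂ) ^ s *
        ((s - 1) * rankinJ₀ N tt.1 f s - (rankinMass N tt.1 f : ℂ) * ((s - 1) / (2 * s) - 1 / 2)) =
      (s - 1) * ((π : ℂ) ^ (-s) * Complex.Gamma s * riemannZeta (2 * s)) *
        (Complex.Gamma (s + 1) * ((4 * π : ℝ) : ℂ) ^ (-(s + 1))) *
        ((μ (N / tt.1) : ℂ) * ((tt.1 : ℂ) ^ s * ((N * tt.1 : ℕ) : ℂ) ^ (s + 1)) *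
          LSeries (fun n ↦ (conjCoeff N tt.1 f n : ℂ)) (s + 1)) := by
    intro tt
    haveI : NeZero tt.1 := ⟨(Nat.pos_of_mem_divisors tt.2).ne'⟩
    rw [rankinJ₀_eq_of_one_lt_re f hs, horocycle_a_cpow]
    field_simp
    ring
  rw [Finset.sum_congr rfl fun tt _ ↦ hterm tt, ← Finset.mul_sum]
  ring

/-- **`Λ_f` is holomorphic on `{Re s > 0}`** (`J_s(N) ≠ 0` there, `J_t` entire, `1/(2s)` harmless).
[cite: Rankin1939, Thm. 3] -/
theorem differentiableOn_rankinLambda (f : CuspForm (Gamma0 N) 2) :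
    DifferentiableOn ℂ (rankinLambda N f) {s : ℂ | 0 < s.re} := by
  have hN : N ≠ 0 := NeZero.ne N
  unfold rankinLambda
  refine ((differentiable_moebiusWeightC N).differentiableOn.inv fun s hs ↦ moebiusWeightC_ne_zero hN hs).mul ?_
  refine DifferentiableOn.fun_sum fun tt _ ↦ ?_
  haveI : NeZero tt.1 := ⟨(Nat.pos_of_mem_divisors tt.2).ne'⟩
  have ht0 : (tt.1 : ℂ) ≠ 0 := by exact_mod_cast NeZero.ne tt.1
  refine (((differentiableOn_const _).mul (differentiable_id.const_cpow (Or.inl ht0)).differentiableOn)).mul ?_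
  refine (((differentiable_id.sub_const 1).mul (differentiable_rankinJ₀ f)).differentiableOn).sub ?_
  refine (differentiableOn_const _).mul ((DifferentiableOn.div ?_ ?_ ?_).sub (differentiableOn_const _))
  · exact (differentiable_id.sub_const 1).differentiableOn
  · exact (differentiable_id.const_mul 2).differentiableOn
  · intro s hs
    exact mul_ne_zero two_ne_zero fun h ↦ by
      have hs' : (0 : ℝ) < s.re := hs
      rw [h, Complex.zero_re] at hs'
      exact lt_irrefl _ hs'

omit [NeZero N] in
/-- **`Λ_f(1) = J_1(N)⁻¹ Σ_{t∣N} μ(N/t) t · V_t/2`**. [cite: Rankin1939, Thm. 3] -/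
theorem rankinLambda_one (f : CuspForm (Gamma0 N) 2) :
    rankinLambda N f 1 = (moebiusWeightC N 1)⁻¹ * ∑ t ∈ N.divisors.attach,
      (μ (N / t.1) : ℂ) * (t.1 : ℂ) * ((rankinMass N t.1 f : ℂ) / 2) := by
  unfold rankinLambda
  congr 1
  refine Finset.sum_congr rfl fun tt _ ↦ ?_
  rw [Complex.cpow_one]
  ring

end Continuation

/-! ### The value at `s = 1`: `Λ_f(1) = Re (f, f)/(2 [SL₂(ℤ):Γ₀(N)])` -/

section Value

variable {N : ℕ} [NeZero N] {t : ℕ} [NeZero t]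

/-- **The mass of the conjugated trace is the Petersson norm**: `V_t = ∫_𝒟 G_f^{(t)} dμ = Re (f, f)`
for `t ∣ N` (`lintegral_fd_conjTrace_eq` and the tree's `peterssonProduct_self_eq_lintegral`,
`lintegral_fd_sum_eq_lintegral_domain`). [cite: Rankin1939, §4] -/
theorem rankinMass_eq_re_peterssonProduct (htN : t ∣ N) (f : CuspForm (Gamma0 N) 2) :
    rankinMass N t f = (peterssonProduct (Gamma0 N) 2 f f).re := by
  classical
  obtain ⟨g, hg⟩ := exists_mapGL_eq_out (N := N)
  letI : Fintype (↥𝒮ℒ ⧸ (Gamma0 N : Subgroup (GL (Fin 2) ℝ)).subgroupOf 𝒮ℒ) := Fintype.ofFinite _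
  rw [peterssonProduct_self_eq_lintegral g hg f, Complex.ofReal_re, lintegral_fd_sum_eq_lintegral_domain g hg f,
    ← lintegral_fd_conjTrace_eq g hg htN f, rankinMass,
    integral_eq_lintegral_of_nonneg_ae (Eventually.of_forall (conjTrace_nonneg (N := N) (t := t) f))
      (continuous_conjTrace (N := N) (t := t) f).measurable.aestronglyMeasurable]

omit [NeZero N] in
/-- `Σ_{de = N} μ(d) e = φ(N)` (Möbius inversion of `Σ_{d∣N} φ(d) = N`). [folklore] -/
theorem sum_divisorsAntidiagonal_moebius_mul_eq_totient (hN : 0 < N) :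
    ∑ x ∈ N.divisorsAntidiagonal, (μ x.1 : ℤ) * (x.2 : ℤ) = (N.totient : ℤ) := by
  have h := (sum_eq_iff_sum_mul_moebius_eq (R := ℤ) (f := fun n ↦ (n.totient : ℤ)) (g := fun n ↦ (n : ℤ))).mp
    (fun n _ ↦ by exact_mod_cast Nat.sum_totient n) N hN
  simpa using h

omit [NeZero N] in
/-- `J_1(N) = [SL₂(ℤ):Γ₀(N)] φ(N)` as a complex number (the tree's
`moebius_mul_sq_eq_gamma0Index_mul_totient`). [folklore] -/
theorem moebiusWeightC_one (hN : N ≠ 0) :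
    moebiusWeightC N 1 = ((gamma0Index N * N.totient : ℕ) : ℂ) := by
  have h := moebius_mul_sq_eq_gamma0Index_mul_totient hN
  have h' : (∑ x ∈ N.divisorsAntidiagonal, ((μ x.1 : ℤ) : ℂ) * ((x.2 : ℤ) : ℂ) ^ 2) =
      (((gamma0Index N * N.totient : ℕ) : ℤ) : ℂ) := by exact_mod_cast congrArg (Int.cast : ℤ → ℂ) h
  rw [moebiusWeightC, mul_one]
  push_cast at h' ⊢
  rw [← h']
  refine Finset.sum_congr rfl fun x _ ↦ ?_
  norm_cast

/-- **`Λ_f(1) = Re (f, f)/(2 [SL₂(ℤ) : Γ₀(N)])`**: the value of the continued function at `s = 1` is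
the Petersson norm over twice the index (consistent with the residue
`Res_{w=2}Σ|aₙ|²n^{-w} = 48π(f,f)/[SL₂(ℤ):Γ₀(N)]`, `Gamma0RankinSelbergResidue`, through
`θ(1)(4π)^{-2} = 1/(96π)`). [cite: Rankin1939, Thm. 3 (the residue at s = k)] -/
theorem rankinLambda_one_eq (f : CuspForm (Gamma0 N) 2) :
    rankinLambda N f 1 = ((peterssonProduct (Gamma0 N) 2 f f).re : ℂ) / (2 * gamma0Index N) := by
  have hN : N ≠ 0 := NeZero.ne N
  have hφ : (N.totient : ℂ) ≠ 0 := by exact_mod_cast (Nat.totient_pos.mpr (NeZero.pos N)).ne'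
  have hidx : (gamma0Index N : ℂ) ≠ 0 := by exact_mod_cast (gamma0Index_pos N).ne'
  rw [rankinLambda_one, moebiusWeightC_one hN]
  -- every mass is `Re (f,f)`
  have hmass : ∀ tt : {x // x ∈ N.divisors}, (rankinMass N tt.1 f : ℂ) = ((peterssonProduct (Gamma0 N) 2 f f).re : ℂ) := by
    intro tt
    haveI : NeZero tt.1 := ⟨(Nat.pos_of_mem_divisors tt.2).ne'⟩
    rw [rankinMass_eq_re_peterssonProduct (Nat.dvd_of_mem_divisors tt.2)]
  simp_rw [hmass]
  have hsum : ∑ tt ∈ N.divisors.attach, (μ (N / tt.1) : ℂ) * (tt.1 : ℂ) = (N.totient : ℂ) := by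
    rw [Finset.sum_attach (f := fun t : ℕ ↦ (μ (N / t) : ℂ) * (t : ℂ)),
      ← Nat.sum_divisorsAntidiagonal' (fun d e ↦ (μ d : ℂ) * (e : ℂ))]
    have h := sum_divisorsAntidiagonal_moebius_mul_eq_totient (NeZero.pos N)
    exact_mod_cast congrArg (Int.cast : ℤ → ℂ) h
  rw [← Finset.sum_mul, hsum]
  push_cast
  field_simp

end Value

end Literature.NumberTheory.EllipticCurves.ModularForms

end
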